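import Summits.ValiantsHypothesis.ValiantsHypothesis.Theses.SymmetroidDescartes
import Summits.ValiantsHypothesis.ValiantsHypothesis.Theorems.SymmetroidDescartesRolleToDescartes
import Summits.ValiantsHypothesis.ValiantsHypothesis.Theorems.BarrierLeverSuccinctHittingSetsForVPDimensionCount

/-!
# ValiantsHypothesis / SymmetroidDescartes — the glue `QuasiRolleToDescartes`

Route `SymmetroidDescartes`, item `stmt-ValiantsHypothesis-18065` (support, rank 9):
`QuasiRolleToDescartes : DerivedPencilRolleQuasi → LacunaryDescartes` — the REPAIRED inductive step on
the number of terms (matrix Rolle against the derived pencil, budget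
`(K+1)^(A·K) · 2^((log₂ m + 2)^A)`) implies the lacunary matrix Descartes rule.

This is the port of `rolleToDescartes_proof` (file `SymmetroidDescartesRolleToDescartes.lean`, the
rev-1 glue for the polynomial budget `(m+K)^a`) to the new budget. To avoid a second verbatim copy
for the next budget change, the iteration and the merging/perturbation steps are proved here for an
ABSTRACT budget `B m K`, monotone in `K`:

1. `posRoots_le_of_step` — a step `Z₊(F) ≤ C·Z₊(∂F) + B m K` for invertible-coefficient strictly
   lacunary symmetric `(K+1)`-term pencils, iterated `K` times, gives `Z₊(F) ≤ (K+1)·C'^K·B m K`,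
   `C' = max C 1` (base: the `K = 0` instance of the step, the derived pencil being empty).
2. `alternations_le_of_step` — for an ARBITRARY symmetric `K`-term pencil, `N` strict sign
   alternations of `det` at increasing positive test points force `N ≤ K·C'^K·B m K`: merge equal
   exponents, perturb `U ↦ U + η•1` off the spectra keeping the signs at the test points, count roots
   in the gaps (`le_card_posRoots_of_alternating`) — verbatim the rev-1 argument.
3. `regime_two_pow_quasi_le` — regime arithmetic: for `m ≤ 2^(c(log₂K+1)²)` and `K ≥ K₀(A,c)`,
   `(log₂ m + 2)^A ≤ ((c+2)(log₂K+1)²)^A ≤ 2^(log₂K) ≤ K`, hence `2^((log₂ m+2)^A) ≤ 2^K ≤ K^K`.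
4. `quasiRolleToDescartes_proof` — with `(K+1)^(A·K) ≤ K^(2A·K)`, `C'^K ≤ K^(C'·K)`, `K ≤ K^K`:
   `N ≤ K^((C'+2A+2)·K)`, so `b := max C 1 + 2A + 2` (depends on `C, A` only).

Sources: Descartes / Pólya–Szegő induction on the number of monomials (Khovanskiĭ 1991, *Fewnomials*
§1.1; Koiran–Portier–Tavenas, arXiv:1205.1015 §2); elementary. No named facts: unconditional
relative to its hypothesis `DerivedPencilRolleQuasi` (the route's rank-2 crux).
-/

-- `Summit.ValiantsHypothesis.ValiantsHypothesis.…` is the tree's mandated single-conjunct layout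
-- (Sub = Summit), so the duplicated namespace component is intended.
set_option linter.dupNamespace false

namespace Summit.ValiantsHypothesis.ValiantsHypothesis.Theorems.SymmetroidDescartes

open scoped BigOperators Topology Classical Matrix Polynomial
open Filter

open Summit.ValiantsHypothesis.ValiantsHypothesis.Theses.SymmetroidDescartes

/-! ### 1. Iterating an inductive step with an abstract budget -/

/-- `K`-fold iteration of an inductive step with constant `C` and budget `B m K` (monotone in `K`):
every `(K+1)`-term pencil `∑ X^(d l) • S l` with real symmetric invertible coefficients and strictly
increasing exponents has at most `(K+1)·(max C 1)^K·B m K` distinct positive roots of its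
determinant. Induction on `K`; the base case is the `K = 0` instance of the step (the derived pencil
is empty and has no positive roots). [folklore] -/
theorem posRoots_le_of_step (C : ℕ) (B : ℕ → ℕ → ℕ)
    (hB : ∀ m K K', K ≤ K' → B m K ≤ B m K')
    (hR : ∀ (m K : ℕ) (S : Fin (K + 1) → Matrix (Fin m) (Fin m) ℝ) (d : Fin (K + 1) → ℕ),
      (∀ l, (S l).IsSymm) → (∀ l, (S l).det ≠ 0) → StrictMono d →
      ((∑ l, (Polynomial.X : ℝ[X]) ^ d l • (S l).map Polynomial.C).det.roots.toFinset.filter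
        (fun t => 0 < t)).card ≤ C * ((∑ l : Fin K, (Polynomial.X : ℝ[X]) ^ (d l.succ - d 0 - 1) •
          (((d l.succ - d 0 : ℕ) : ℝ) • S l.succ).map Polynomial.C).det.roots.toFinset.filter
        (fun t => 0 < t)).card + B m K) :
    ∀ (K m : ℕ) (S : Fin (K + 1) → Matrix (Fin m) (Fin m) ℝ) (d : Fin (K + 1) → ℕ),
      (∀ l, (S l).IsSymm) → (∀ l, (S l).det ≠ 0) → StrictMono d →
      ((∑ l, (Polynomial.X : ℝ[X]) ^ d l • (S l).map Polynomial.C).det.roots.toFinset.filter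
        (fun t => 0 < t)).card ≤ (K + 1) * (max C 1) ^ K * B m K := by
  intro K
  induction K with
  | zero =>
    intro m S d hS hdet hd
    have h0 := hR m 0 S d hS hdet hd
    rw [card_filter_roots_det_sum_fin_zero] at h0
    simpa using h0
  | succ K ih =>
    intro m S d hS hdet hd
    have h1 := hR m (K + 1) S d hS hdet hd
    have h0d : ∀ l : Fin (K + 1), d 0 < d l.succ := fun l => hd (Fin.succ_pos l)
    have ih' := ih m (fun l => ((d l.succ - d 0 : ℕ) : ℝ) • S l.succ) (fun l => d l.succ - d 0 - 1)
      (fun l => (hS l.succ).smul _)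
      (fun l => by
        rw [Matrix.det_smul]
        refine mul_ne_zero (pow_ne_zero _ ?_) (hdet l.succ)
        have := h0d l
        exact_mod_cast (show (d l.succ - d 0 : ℕ) ≠ 0 by omega))
      (fun i j hij => by
        have h1 := hd (Fin.succ_lt_succ_iff.2 hij)
        have h2 := h0d i
        show d i.succ - d 0 - 1 < d j.succ - d 0 - 1
        omega)
    calc _ ≤ C * _ + B m (K + 1) := h1
      _ ≤ max C 1 * ((K + 1) * max C 1 ^ K * B m (K + 1))
          + max C 1 ^ (K + 1) * B m (K + 1) := by
        refine Nat.add_le_add (Nat.mul_le_mul (le_max_left _ _) (ih'.trans ?_))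
          (Nat.le_mul_of_pos_left _ (by positivity))
        exact Nat.mul_le_mul_left _ (hB m K (K + 1) (Nat.le_succ K))
      _ = (K + 1 + 1) * max C 1 ^ (K + 1) * B m (K + 1) := by ring

/-! ### 2. Merging and perturbation with an abstract budget -/

/-- For an ARBITRARY real symmetric `K`-term lacunary pencil (repeated exponents and singular
coefficients allowed), the number `N` of strict sign alternations of its determinant along a strictly
increasing positive sequence of test points is at most `K·C^K·B m K`, given the iterated bound
`(K+1)·C^K·B m K` (`C ≥ 1`, `B m ·` monotone) on distinct positive roots for invertible-coefficient
strictly lacunary `(K+1)`-term pencils. Merge equal exponents, perturb the coefficients by `η • 1`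
(`η > 0` small, off the spectra), count roots between test points. [folklore] -/
theorem alternations_le_of_step (C : ℕ) (hC : 1 ≤ C) (B : ℕ → ℕ → ℕ)
    (hB : ∀ m K K', K ≤ K' → B m K ≤ B m K')
    (hiter : ∀ (K m : ℕ) (S : Fin (K + 1) → Matrix (Fin m) (Fin m) ℝ) (d : Fin (K + 1) → ℕ),
      (∀ l, (S l).IsSymm) → (∀ l, (S l).det ≠ 0) → StrictMono d →
      ((∑ l, (Polynomial.X : ℝ[X]) ^ d l • (S l).map Polynomial.C).det.roots.toFinset.filter
        (fun t => 0 < t)).card ≤ (K + 1) * C ^ K * B m K)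
    (K m : ℕ) (S : Fin K → Matrix (Fin m) (Fin m) ℝ) (d : Fin K → ℕ) (hS : ∀ l, (S l).IsSymm)
    (N : ℕ) (τ : Fin (N + 1) → ℝ) (hτ : StrictMono τ) (hpos : ∀ j, 0 < τ j)
    (halt : ∀ j : Fin N,
      ((∑ l, (Polynomial.X : ℝ[X]) ^ d l • (S l).map Polynomial.C).det).eval (τ j.castSucc) *
      ((∑ l, (Polynomial.X : ℝ[X]) ^ d l • (S l).map Polynomial.C).det).eval (τ j.succ) < 0) :
    N ≤ K * C ^ K * B m K := by
  rcases Nat.eq_zero_or_pos N with hN | hN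
  · simp [hN]
  have heval : ∀ t, ((∑ l, (Polynomial.X : ℝ[X]) ^ d l • (S l).map Polynomial.C).det).eval t
      = (∑ l, t ^ d l • S l).det := eval_det_pencil S d
  -- `K > 0`: an empty pencil has a constant determinant, which cannot alternate.
  have hK : 0 < K := by
    rcases Nat.eq_zero_or_pos K with hK | hK
    · exfalso
      subst hK
      have h0 := halt ⟨0, hN⟩
      rw [heval, heval] at h0
      simp only [Finset.univ_eq_empty, Finset.sum_empty] at h0
      exact absurd h0 (not_lt.2 (mul_self_nonneg _))
    · exact hK
  -- (a) merge equal exponents: `k + 1` distinct exponents, enumerated increasingly by `e`.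
  have hEpos : 0 < (Finset.univ.image d).card := by
    haveI : Nonempty (Fin K) := Fin.pos_iff_nonempty.1 hK
    exact Finset.card_pos.2 (Finset.univ_nonempty.image d)
  obtain ⟨k, hk⟩ : ∃ k, (Finset.univ.image d).card = k + 1 := ⟨_, (Nat.succ_pred_eq_of_pos hEpos).symm⟩
  have hkK : k + 1 ≤ K := by
    rw [← hk]
    exact Finset.card_image_le.trans (by simp)
  obtain ⟨e, himg⟩ : ∃ e : Fin (k + 1) ↪o ℕ, Finset.univ.image e = Finset.univ.image d :=
    ⟨_, Finset.image_orderEmbOfFin_univ _ hk⟩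
  obtain ⟨U, hU⟩ : ∃ U : ℕ → Matrix (Fin m) (Fin m) ℝ,
      ∀ n, U n = ∑ l ∈ Finset.univ.filter (fun l => d l = n), S l := ⟨_, fun _ => rfl⟩
  have hUsymm : ∀ n, (U n).IsSymm := by
    intro n
    rw [hU]
    exact Finset.sum_induction _ Matrix.IsSymm (fun _ _ ha hb => ha.add hb) Matrix.isSymm_zero
      (fun l _ => hS l)
  have hmerge : ∀ t : ℝ, ∑ i : Fin (k + 1), t ^ (e i) • U (e i) = ∑ l, t ^ d l • S l := by
    intro t
    calc ∑ i : Fin (k + 1), t ^ (e i) • U (e i)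
        = ∑ n ∈ Finset.univ.image e, t ^ n • U n := by
          rw [Finset.sum_image fun x _ y _ hxy => e.injective hxy]
      _ = ∑ n ∈ Finset.univ.image d, ∑ l ∈ Finset.univ.filter (fun l => d l = n), t ^ d l • S l := by
          rw [himg]
          refine Finset.sum_congr rfl fun n _ => ?_
          rw [hU, Finset.smul_sum]
          refine Finset.sum_congr rfl fun l hl => ?_
          rw [(Finset.mem_filter.1 hl).2]
      _ = ∑ l, t ^ d l • S l :=
          Finset.sum_fiberwise_of_maps_to (fun l _ => Finset.mem_image_of_mem d (Finset.mem_univ l)) _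
  -- (b) perturb: `f η t` is the determinant of the perturbed merged pencil at `t`.
  obtain ⟨f, hf⟩ : ∃ f : ℝ → ℝ → ℝ, ∀ η t, f η t =
      (∑ i : Fin (k + 1), t ^ (e i) • (U (e i) + η • (1 : Matrix (Fin m) (Fin m) ℝ))).det :=
    ⟨_, fun _ _ => rfl⟩
  have hf0 : ∀ t, f 0 t
      = ((∑ l, (Polynomial.X : ℝ[X]) ^ d l • (S l).map Polynomial.C).det).eval t := by
    intro t
    simp only [hf, zero_smul, add_zero, hmerge, heval]
  have hfcont : ∀ t, Continuous fun η => f η t := by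
    intro t
    simp only [hf]
    have hci : ∀ i : Fin (k + 1), Continuous fun η : ℝ =>
        t ^ (e i) • (U (e i) + η • (1 : Matrix (Fin m) (Fin m) ℝ)) := fun i =>
      ((continuous_const : Continuous fun _ : ℝ => U (e i)).add
        (continuous_id.smul (continuous_const : Continuous fun _ : ℝ =>
          (1 : Matrix (Fin m) (Fin m) ℝ)))).const_smul (t ^ (e i))
    exact Continuous.matrix_det (continuous_finsetSum _ fun i _ => hci i)
  -- the determinant does not vanish at the test points
  have hf0ne : ∀ j : Fin (N + 1), f 0 (τ j) ≠ 0 := by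
    intro j
    rw [hf0]
    by_cases hj : (j : ℕ) < N
    · have h1 := halt ⟨j, hj⟩
      have hj' : (⟨j, hj⟩ : Fin N).castSucc = j := Fin.ext rfl
      rw [hj'] at h1
      intro h0
      rw [h0, zero_mul] at h1
      exact lt_irrefl _ h1
    · have hjN : (j : ℕ) = N := by omega
      have h1 := halt ⟨N - 1, by omega⟩
      have hj' : (⟨N - 1, by omega⟩ : Fin N).succ = j := Fin.ext (by simp only [Fin.val_succ]; omega)
      rw [hj'] at h1
      intro h0
      rw [h0, mul_zero] at h1
      exact lt_irrefl _ h1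
  -- signs at the test points are preserved for `η` near `0`
  have hsign : ∀ᶠ η in 𝓝 (0 : ℝ), ∀ j : Fin (N + 1), 0 < f η (τ j) * f 0 (τ j) := by
    refine Filter.eventually_all.2 fun j => ?_
    have h0 : 0 < f 0 (τ j) * f 0 (τ j) := mul_self_pos.2 (hf0ne j)
    exact (((hfcont (τ j)).mul continuous_const).tendsto 0).eventually (lt_mem_nhds h0)
  obtain ⟨ε, hε, hεsign⟩ := Metric.eventually_nhds_iff.1 hsign
  -- the perturbed coefficients are invertible off a finite set of `η`
  have hcharpoly : ∀ (n : ℕ) (η : ℝ),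
      (-(U n)).charpoly.eval η = (U n + η • (1 : Matrix (Fin m) (Fin m) ℝ)).det := by
    intro n η
    rw [Matrix.charpoly, ← Polynomial.coe_evalRingHom, RingHom.map_det]
    congr 1
    ext i j
    by_cases hij : i = j
    · subst hij
      simp [add_comm]
    · simp [hij]
  have hbad : {η : ℝ | ∃ i : Fin (k + 1),
      (U (e i) + η • (1 : Matrix (Fin m) (Fin m) ℝ)).det = 0}.Finite := by
    refine (Set.finite_iUnion fun i : Fin (k + 1) =>
      Polynomial.finite_setOf_isRoot (Matrix.charpoly_monic (-(U (e i)))).ne_zero).subset ?_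
    rintro η ⟨i, hi⟩
    exact Set.mem_iUnion.2 ⟨i, by simp only [Set.mem_setOf_eq, Polynomial.IsRoot.def, hcharpoly, hi]⟩
  obtain ⟨η, ⟨hη0, hηε⟩, hηbad⟩ := ((Set.Ioo_infinite hε).sdiff hbad).nonempty
  have hηdet : ∀ i : Fin (k + 1), (U (e i) + η • (1 : Matrix (Fin m) (Fin m) ℝ)).det ≠ 0 :=
    fun i hi => hηbad ⟨i, hi⟩
  have hηsign : ∀ j : Fin (N + 1), 0 < f η (τ j) * f 0 (τ j) :=
    hεsign (by rw [Real.dist_eq, sub_zero, abs_lt]; constructor <;> linarith)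
  -- (c) the perturbed merged pencil: invertible symmetric coefficients, sorted distinct exponents
  obtain ⟨S', hS'⟩ : ∃ S' : Fin (k + 1) → Matrix (Fin m) (Fin m) ℝ,
      ∀ i, S' i = U (e i) + η • (1 : Matrix (Fin m) (Fin m) ℝ) := ⟨_, fun _ => rfl⟩
  obtain ⟨d', hd'⟩ : ∃ d' : Fin (k + 1) → ℕ, ∀ i, d' i = e i := ⟨_, fun _ => rfl⟩
  have heval' : ∀ t, ((∑ i, (Polynomial.X : ℝ[X]) ^ d' i • (S' i).map Polynomial.C).det).eval t
      = f η t := by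
    intro t
    rw [eval_det_pencil, hf]
    simp only [hS', hd']
  have halt' : ∀ j : Fin N,
      ((∑ i, (Polynomial.X : ℝ[X]) ^ d' i • (S' i).map Polynomial.C).det).eval (τ j.castSucc) *
      ((∑ i, (Polynomial.X : ℝ[X]) ^ d' i • (S' i).map Polynomial.C).det).eval (τ j.succ) < 0 := by
    intro j
    rw [heval', heval']
    have h1 := hηsign j.castSucc
    have h2 := hηsign j.succ
    have h3 := halt j
    rw [← hf0, ← hf0] at h3
    by_contra hcon
    have hcon : 0 ≤ f η (τ j.castSucc) * f η (τ j.succ) := not_lt.1 hcon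
    have h4 : 0 < (f η (τ j.castSucc) * f η (τ j.succ)) * (f 0 (τ j.castSucc) * f 0 (τ j.succ)) := by
      have := mul_pos h1 h2
      linarith [show (f η (τ j.castSucc) * f 0 (τ j.castSucc)) * (f η (τ j.succ) * f 0 (τ j.succ))
        = (f η (τ j.castSucc) * f η (τ j.succ)) * (f 0 (τ j.castSucc) * f 0 (τ j.succ)) by ring]
    have h5 : (f η (τ j.castSucc) * f η (τ j.succ)) * (f 0 (τ j.castSucc) * f 0 (τ j.succ)) ≤ 0 :=
      mul_nonpos_of_nonneg_of_nonpos hcon h3.le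
    linarith
  have hN' := le_card_posRoots_of_alternating _ N τ hτ hpos halt'
  have hZ := hiter k m S' d' (fun i => by rw [hS']; exact (hUsymm _).add (Matrix.isSymm_one.smul η))
    (fun i => by rw [hS']; exact hηdet i) (fun i j hij => by rw [hd', hd']; exact e.strictMono hij)
  calc N ≤ _ := hN'
    _ ≤ (k + 1) * C ^ k * B m k := hZ
    _ ≤ K * C ^ K * B m K :=
        Nat.mul_le_mul (Nat.mul_le_mul hkK (Nat.pow_le_pow_right hC (by omega)))
          (hB m k K (by omega))

/-! ### 3. The quasi-polynomial budget and the regime arithmetic -/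

/-- The budget `(K+1)^(A·K) · 2^((log₂ m+2)^A)` of `DerivedPencilRolleQuasi` is monotone in the
number of terms `K`. [folklore] -/
theorem quasiBudget_mono (A m K K' : ℕ) (h : K ≤ K') :
    (K + 1) ^ (A * K) * 2 ^ (Nat.log 2 m + 2) ^ A
      ≤ (K' + 1) ^ (A * K') * 2 ^ (Nat.log 2 m + 2) ^ A := by
  refine Nat.mul_le_mul_right _ ?_
  calc (K + 1) ^ (A * K) ≤ (K' + 1) ^ (A * K) := Nat.pow_le_pow_left (by omega) _
    _ ≤ (K' + 1) ^ (A * K') := Nat.pow_le_pow_right (Nat.succ_pos _) (Nat.mul_le_mul_left _ h)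

/-- Regime arithmetic: in the quasi-polynomial regime `m ≤ 2^(c(log₂K+1)²)`, for all `K ≥ K₀(A,c)`
(with `K₀ ≥ 2`) one has `2^((log₂ m + 2)^A) ≤ K^K` — because
`(log₂ m + 2)^A ≤ ((c+2)(log₂K+1)²)^A ≤ 2^(log₂ K) ≤ K` eventually, and `2^K ≤ K^K`. [folklore] -/
theorem regime_two_pow_quasi_le (A c : ℕ) : ∃ K₀ : ℕ, 2 ≤ K₀ ∧ ∀ K ≥ K₀,
    ∀ m ≤ 2 ^ (c * (Nat.log 2 K + 1) ^ 2), 2 ^ (Nat.log 2 m + 2) ^ A ≤ K ^ K := by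
  obtain ⟨n₀, hn₀⟩ :=
    BarrierLever.SuccinctHittingSetsForVP.LowDegreeEquations.eventually_mul_pow_le_two_pow
      (2 * (c + 2) ^ A) (2 * A)
  refine ⟨2 ^ max 1 n₀, ?_, fun K hK m hm => ?_⟩
  · calc (2 : ℕ) = 2 ^ 1 := by norm_num
      _ ≤ 2 ^ max 1 n₀ := Nat.pow_le_pow_right (by norm_num) (le_max_left _ _)
  set L := Nat.log 2 K with hL
  have hK0 : K ≠ 0 := by
    have : 0 < 2 ^ max 1 n₀ := by positivity
    omega
  have hK2 : 2 ≤ K :=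
    le_trans (by simpa using Nat.pow_le_pow_right (show 0 < 2 by norm_num) (le_max_left 1 n₀)) hK
  have h1 : 2 ^ L ≤ K := Nat.pow_log_le_self 2 hK0
  have hLn : max 1 n₀ ≤ L := Nat.le_log_of_pow_le one_lt_two hK
  have hlogm : Nat.log 2 m ≤ c * (L + 1) ^ 2 := by
    calc Nat.log 2 m ≤ Nat.log 2 (2 ^ (c * (L + 1) ^ 2)) := Nat.log_mono_right hm
      _ = c * (L + 1) ^ 2 := Nat.log_pow one_lt_two _
  have hL1 : 1 ≤ (L + 1) ^ 2 := Nat.one_le_pow _ _ (Nat.succ_pos L)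
  have hbase : Nat.log 2 m + 2 ≤ (c + 2) * (L + 1) ^ 2 := by
    calc Nat.log 2 m + 2 ≤ c * (L + 1) ^ 2 + 2 * (L + 1) ^ 2 :=
          Nat.add_le_add hlogm (by linarith)
      _ = (c + 2) * (L + 1) ^ 2 := by ring
  have h3 : (c + 2) ^ A * (L + 1) ^ (2 * A) ≤ 2 ^ L := by
    have h := hn₀ (L + 1) (by omega)
    rw [mul_assoc, pow_succ'] at h
    exact Nat.le_of_mul_le_mul_left h (by norm_num)
  have h2 : (Nat.log 2 m + 2) ^ A ≤ K := by
    calc (Nat.log 2 m + 2) ^ A ≤ ((c + 2) * (L + 1) ^ 2) ^ A := Nat.pow_le_pow_left hbase _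
      _ = (c + 2) ^ A * (L + 1) ^ (2 * A) := by rw [mul_pow, ← pow_mul]
      _ ≤ 2 ^ L := h3
      _ ≤ K := h1
  calc 2 ^ (Nat.log 2 m + 2) ^ A ≤ 2 ^ K := Nat.pow_le_pow_right (by norm_num) h2
    _ ≤ K ^ K := Nat.pow_le_pow_left hK2 K

/-! ### 4. The item -/

/-- Settles `stmt-ValiantsHypothesis-18065` (`QuasiRolleToDescartes`, route `SymmetroidDescartes`):
the repaired inductive step `DerivedPencilRolleQuasi` (matrix Rolle against the derived pencil,
constants `C, A`, budget `(K+1)^(A·K)·2^((log₂ m+2)^A)`) implies the lacunary matrix Descartes rule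
`LacunaryDescartes` with `b := max C 1 + 2A + 2` — iterate the step down to one term, merge equal
exponents, perturb the coefficients off their spectra, count roots between consecutive test points,
and absorb `K·C'^K·(K+1)^(A·K)·2^((log₂ m+2)^A)` into `K^(bK)` in the regime `m ≤ 2^(c(log₂K+1)²)`.
[folklore] -/
theorem quasiRolleToDescartes_proof :
    Summit.ValiantsHypothesis.ValiantsHypothesis.Theses.SymmetroidDescartes.QuasiRolleToDescartes := by
  unfold Summit.ValiantsHypothesis.ValiantsHypothesis.Theses.SymmetroidDescartes.QuasiRolleToDescartes
  intro hQuasi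
  obtain ⟨C, A, hR⟩ := hQuasi
  have hiter := posRoots_le_of_step C
    (fun m K => (K + 1) ^ (A * K) * 2 ^ (Nat.log 2 m + 2) ^ A)
    (fun m K K' h => quasiBudget_mono A m K K' h) hR
  unfold Summit.ValiantsHypothesis.ValiantsHypothesis.Theses.SymmetroidDescartes.LacunaryDescartes
  refine ⟨max C 1 + 2 * A + 2, fun c => ?_⟩
  obtain ⟨K₀, hK₀2, hK₀⟩ := regime_two_pow_quasi_le A c
  refine ⟨K₀, fun K hK m hm S d hS N τ hτ hpos halt => ?_⟩
  have hK2 : 2 ≤ K := hK₀2.trans hK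
  have hKK : K ≠ 0 := by omega
  have hA := alternations_le_of_step (max C 1) (le_max_right _ _)
    (fun m K => (K + 1) ^ (A * K) * 2 ^ (Nat.log 2 m + 2) ^ A)
    (fun m K K' h => quasiBudget_mono A m K K' h) hiter K m S d hS N τ hτ hpos halt
  have hCK : max C 1 ^ K ≤ K ^ (max C 1 * K) :=
    calc max C 1 ^ K ≤ (K ^ max C 1) ^ K :=
          Nat.pow_le_pow_left ((max C 1).lt_two_pow_self.le.trans (Nat.pow_le_pow_left hK2 _)) K
      _ = K ^ (max C 1 * K) := by rw [← pow_mul]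
  have hK1 : (K + 1) ^ (A * K) ≤ K ^ (2 * A * K) :=
    calc (K + 1) ^ (A * K) ≤ (K ^ 2) ^ (A * K) := Nat.pow_le_pow_left (by nlinarith) _
      _ = K ^ (2 * A * K) := by rw [← pow_mul, mul_assoc]
  have h2m : 2 ^ (Nat.log 2 m + 2) ^ A ≤ K ^ K := hK₀ K hK m hm
  calc N ≤ K * max C 1 ^ K * ((K + 1) ^ (A * K) * 2 ^ (Nat.log 2 m + 2) ^ A) := hA
    _ ≤ K ^ K * K ^ (max C 1 * K) * (K ^ (2 * A * K) * K ^ K) :=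
        Nat.mul_le_mul (Nat.mul_le_mul (Nat.le_self_pow hKK K) hCK) (Nat.mul_le_mul hK1 h2m)
    _ = K ^ ((max C 1 + 2 * A + 2) * K) := by ring

end Summit.ValiantsHypothesis.ValiantsHypothesis.Theorems.SymmetroidDescartes
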